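import Literature.AlgebraicGeometry.Frobenioids.PrimaryStepsPrimeClasses
import Literature.AlgebraicGeometry.Frobenioids.PrimaryStepsComplete
import Literature.AlgebraicGeometry.Frobenioids.PreFrobenioidEquivalence
import HarnessLib

/-!
# Frobenioids I, Theorem 4.2 (ii): the bijection `Ψ^Prime : Prime(Φ₁(A₁)) ≅ Prime(Φ₂(A₂))` induced by
# an equivalence that preserves pre-steps and primary steps

Mochizuki, *The geometry of Frobenioids I: the general theory*, Kyushu J. Math. **62** (2008)
293–400, §4, Theorem 4.2 (ii), kurims text pp. 77–79 [cite: MochizukiFrdI2008, Thm. 4.2 (ii) p.77]: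
"There exists a unique isomorphism `Ψ^Prime` between the functors `A_i ↦ Prime(Φ_i(A_i))` …
Suppose that `A₂ = Ψ(A₁)`; `𝔭₁ ∈ Prime(Φ₁(A₁))`, `𝔭₂ ∈ Prime(Φ₂(A₂))` correspond under `Ψ^Prime` …
the map induced by `Ψ` on pre-steps [cf. (i); Theorem 3.4, (ii)] …".

PROVED here, at one object `A` (the transport step of the printed proof, p. 79): for Frobenioids
`C_i → F_{Φ_i}` of isotropic type with `Φ_i` perf-factorial and an equivalence `Ψ : C₁ ≌ C₂` such that
`Ψ` and `Ψ⁻¹` preserve pre-steps [Thm. 3.4 (ii)] and primary pre-steps into `A` resp. `Ψ(A)` [Thm. 4.2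
(i)] — taken as HYPOTHESES (`hpre`, `hpre'`, `hprim`, `hprim'`), to be discharged by those theorems —
there is a UNIQUE bijection `Prime(Φ₁(A)) ≃ Prime(Φ₂(Ψ A))` under which the prime of `x_ε = ε_*(Div ε)`
corresponds to the prime of `x_{Ψ(ε)}` for every primary pre-step `ε` into `A`
(`existsUnique_primesEquiv`). Ingredients: the category-theoretic description of `Prime(Φ(A))` as
primary steps into `A` modulo "not co-primary" (`PrimaryStepsPrimeClasses.lean`, Prop. 4.1 (iii)),
transport of co-primality along `Ψ` (`coprimary_map_iff`), and Def. 1.3 (iii)(d) (every element of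
`Φ(A)` is an `x_ζ`). Naturality in `A ∈ C^{bs-iso}` and the `Order(Φ(A)_𝔭)` equivalences of (ii) are not
in this file. Composition is diagrammatic; monoids multiplicative. No new definitions.
-/

namespace Literature.AlgebraicGeometry.Frobenioids

open CategoryTheory Opposite

namespace PreFrobenioid

universe w v v' u u' w₂ v₂ v₂' u₂ u₂'

variable {D : Type u} [Category.{v} D] {Φ : Dᵒᵖ ⥤ CommMonCat.{w}}
  {C : Type u'} [Category.{v'} C] {F : C ⥤ ElemFrobenioid Φ}

/-! ### Composition with an isomorphism does not change primality (for `x_ζ` itself see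
`invDiv_iso_comp` in `PreFrobenioidEquivalence.lean`) -/

/-- A primary pre-step pre-composed with an isomorphism is a primary pre-step.
[cite: MochizukiFrdI2008, Def. 1.2(iii) p.22] -/
theorem IsPrimaryPreStep.iso_comp (hP : IsPreFrobenioid Φ F) {Z' Z A : C} (e : Z' ⟶ Z) [IsIso e]
    {ζ : Z ⟶ A} (hζ : IsPrimaryPreStep F ζ) : IsPrimaryPreStep F (e ≫ ζ) := by
  refine ⟨IsPreStep.comp F (isPreStep_of_isIso F e) hζ.1, ?_⟩
  rw [div_comp_of_isLinear e hζ.1.1, show Div F e = 1 from isIsometry_of_isIso F hP e, mul_one]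
  haveI : IsIso (Base F e) := isBaseIso_of_isIso F e
  exact (isPrimary_pull_iff (Base F e) _).mpr hζ.2

/-- A primary pre-step post-composed with an isomorphism is a primary pre-step (`Div` is unchanged).
[cite: MochizukiFrdI2008, Def. 1.2(iii) p.22] -/
theorem IsPrimaryPreStep.comp_iso (hP : IsPreFrobenioid Φ F) {Z A A' : C} {ζ : Z ⟶ A}
    (hζ : IsPrimaryPreStep F ζ) (e : A ⟶ A') [IsIso e] : IsPrimaryPreStep F (ζ ≫ e) := by
  refine ⟨IsPreStep.comp F hζ.1 (isPreStep_of_isIso F e), ?_⟩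
  rw [div_comp_of_isLinear ζ (isLinear_of_isIso F e),
    show Div F e = 1 from isIsometry_of_isIso F hP e, map_one, one_mul]
  exact hζ.2

/-- A pre-step `ζ` with `x_ζ` primary is a primary pre-step. [cite: MochizukiFrdI2008, Def. 1.3(iii) p.25] -/
theorem isPrimaryPreStep_of_isPrimary_invDiv {Z A : C} {ζ : Z ⟶ A} (hζ : IsPreStep F ζ)
    (hx : IsPrimary (invDiv F ζ hζ.2)) : IsPrimaryPreStep F ζ := by
  haveI : IsIso (Base F ζ) := hζ.2
  have h := (isPrimary_pull_iff (Base F ζ) (invDiv F ζ hζ.2)).mpr hx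
  rw [pull_invDiv] at h
  exact ⟨hζ, h⟩

/-- Every prime of `Φ(A)` is the prime of `x_ζ` for some primary pre-step `ζ` into `A` (Def. 1.3
(iii)(d)). [cite: MochizukiFrdI2008, Def. 1.3(iii) p.25] -/
theorem exists_isPrimaryPreStep_invDiv_mem (hF : IsFrobenioid F) (A : C)
    (𝔭 : Primes (Φ.obj (op (baseObj F A)))) :
    ∃ (Z : C) (ζ : Z ⟶ A) (hζ : IsPrimaryPreStep F ζ), invDiv F ζ hζ.1.2 ∈ 𝔭.carrier := by
  obtain ⟨⟨p, hp⟩, hp𝔭⟩ := Quotient.exists_rep 𝔭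
  obtain ⟨Z, ζ, hζ, hζx⟩ := hF.iii_d_over_surj A p
  have hprim : IsPrimaryPreStep F ζ := isPrimaryPreStep_of_isPrimary_invDiv hζ.2 (hζx ▸ hp)
  refine ⟨Z, ζ, hprim, ?_⟩
  have e : invDiv F ζ hprim.1.2 = p := hζx
  rw [e, ← hp𝔭]
  exact ⟨hp, rfl⟩

/-! ### Transport along an equivalence -/

variable {D₂ : Type u₂} [Category.{v₂} D₂] {Φ₂ : D₂ᵒᵖ ⥤ CommMonCat.{w₂}}
  {C₂ : Type u₂'} [Category.{v₂'} C₂] {F₂ : C₂ ⥤ ElemFrobenioid Φ₂} (Ψ : C ≌ C₂)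

set_option backward.isDefEq.respectTransparency false in
/-- Co-primality (Prop. 4.1 (iii)) of `ε, ι` is equivalent to co-primality of `Ψ(ε), Ψ(ι)` for an
equivalence `Ψ` such that `Ψ`, `Ψ⁻¹` preserve pre-steps ("the map induced by `Ψ` on pre-steps", FrdI
p. 79). [cite: MochizukiFrdI2008, Thm. 4.2 (ii) p.77] -/
theorem coprimary_map_iff
    (hpre : ∀ ⦃X Y : C⦄ (φ : X ⟶ Y), IsPreStep F φ → IsPreStep F₂ (Ψ.functor.map φ))
    (hpre' : ∀ ⦃X Y : C₂⦄ (φ : X ⟶ Y), IsPreStep F₂ φ → IsPreStep F (Ψ.inverse.map φ))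
    {E I A : C} (ε : E ⟶ A) (ι : I ⟶ A) :
    (∀ ⦃Z : C₂⦄ (ζ : Z ⟶ Ψ.functor.obj A), IsPreStep F₂ ζ →
        (∃ (ε' : Ψ.functor.obj E ⟶ Z) (ι' : Ψ.functor.obj I ⟶ Z), IsPreStep F₂ ε' ∧ IsPreStep F₂ ι' ∧
          ε' ≫ ζ = Ψ.functor.map ε ∧ ι' ≫ ζ = Ψ.functor.map ι) → IsIso ζ) ↔
      ∀ ⦃Z : C⦄ (ζ : Z ⟶ A), IsPreStep F ζ →
        (∃ (ε' : E ⟶ Z) (ι' : I ⟶ Z), IsPreStep F ε' ∧ IsPreStep F ι' ∧ ε' ≫ ζ = ε ∧ ι' ≫ ζ = ι) →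
          IsIso ζ := by
  constructor
  · rintro h Z ζ hζ ⟨ε', ι', hε', hι', eε, eι⟩
    haveI : IsIso (Ψ.functor.map ζ) := h (Ψ.functor.map ζ) (hpre ζ hζ)
      ⟨Ψ.functor.map ε', Ψ.functor.map ι', hpre ε' hε', hpre ι' hι',
        by rw [← Functor.map_comp, eε], by rw [← Functor.map_comp, eι]⟩
    exact Ψ.fullyFaithfulFunctor.isIso_of_isIso_map ζ
  · rintro h Z ζ hζ ⟨ε', ι', hε', hι', eε, eι⟩
    -- transport the factorisation back to `C` along `Ψ⁻¹` and the unit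
    have hcε : Ψ.inverse.map ε' ≫ Ψ.inverse.map ζ = Ψ.unitInv.app E ≫ ε ≫ Ψ.unit.app A := by
      rw [← Functor.map_comp, eε, Ψ.inv_fun_map]
    have hcι : Ψ.inverse.map ι' ≫ Ψ.inverse.map ζ = Ψ.unitInv.app I ≫ ι ≫ Ψ.unit.app A := by
      rw [← Functor.map_comp, eι, Ψ.inv_fun_map]
    haveI key : IsIso (Ψ.inverse.map ζ ≫ Ψ.unitInv.app A) :=
      h _ (IsPreStep.comp F (hpre' ζ hζ) (isPreStep_of_isIso F (Ψ.unitInv.app A)))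
        ⟨Ψ.unit.app E ≫ Ψ.inverse.map ε', Ψ.unit.app I ≫ Ψ.inverse.map ι',
          IsPreStep.comp F (isPreStep_of_isIso F (Ψ.unit.app E)) (hpre' ε' hε'),
          IsPreStep.comp F (isPreStep_of_isIso F (Ψ.unit.app I)) (hpre' ι' hι'),
          by simp [reassoc_of% hcε], by simp [reassoc_of% hcι]⟩
    haveI : IsIso (Ψ.inverse.map ζ) := IsIso.of_isIso_comp_right (Ψ.inverse.map ζ) (Ψ.unitInv.app A)
    exact Ψ.fullyFaithfulInverse.isIso_of_isIso_map ζ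

set_option backward.isDefEq.respectTransparency false in
/-- **Theorem 4.2 (ii) at an object** (FrdI pp. 77–79): for Frobenioids of isotropic type with
perf-factorial divisor monoids and an equivalence `Ψ` which, together with `Ψ⁻¹`, preserves pre-steps
[Thm. 3.4 (ii)] and primary pre-steps into `A` resp. `Ψ(A)` [Thm. 4.2 (i)], there is a UNIQUE bijection
`Ψ^Prime_A : Prime(Φ₁(A)) ≃ Prime(Φ₂(Ψ A))` such that for every primary pre-step `ε : E → A` the prime
of `x_ε` is carried to the prime of `x_{Ψ(ε)}`. [cite: MochizukiFrdI2008, Thm. 4.2 (ii) p.77] -/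
theorem existsUnique_primesEquiv (hF : IsFrobenioid F) (hF₂ : IsFrobenioid F₂)
    (histr : IsOfIsotropicType F) (histr₂ : IsOfIsotropicType F₂)
    (hpf : Objectwise (fun M _ => IsPerfFactorial M) Φ)
    (hpf₂ : Objectwise (fun M _ => IsPerfFactorial M) Φ₂)
    (hpre : ∀ ⦃X Y : C⦄ (φ : X ⟶ Y), IsPreStep F φ → IsPreStep F₂ (Ψ.functor.map φ))
    (hpre' : ∀ ⦃X Y : C₂⦄ (φ : X ⟶ Y), IsPreStep F₂ φ → IsPreStep F (Ψ.inverse.map φ))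
    (A : C)
    (hprim : ∀ ⦃E : C⦄ (ε : E ⟶ A), IsPrimaryPreStep F ε → IsPrimaryPreStep F₂ (Ψ.functor.map ε))
    (hprim' : ∀ ⦃Z : C₂⦄ (ξ : Z ⟶ Ψ.functor.obj A),
      IsPrimaryPreStep F₂ ξ → IsPrimaryPreStep F (Ψ.inverse.map ξ)) :
    ∃! e : Primes (Φ.obj (op (baseObj F A))) ≃ Primes (Φ₂.obj (op (baseObj F₂ (Ψ.functor.obj A)))),
      ∀ ⦃E : C⦄ (ε : E ⟶ A) (hε : IsPrimaryPreStep F ε) (𝔭 : Primes (Φ.obj (op (baseObj F A)))),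
        invDiv F ε hε.1.2 ∈ 𝔭.carrier → invDiv F₂ (Ψ.functor.map ε) (hprim ε hε).1.2 ∈ (e 𝔭).carrier := by
  classical
  have hP := hF.isPreFrobenioid
  have hP₂ := hF₂.isPreFrobenioid
  -- notation-free abbreviations of the two "same prime" criteria
  have same₁ : ∀ {E I : C} {ε : E ⟶ A} {ι : I ⟶ A} (hε : IsPrimaryPreStep F ε)
      (hι : IsPrimaryPreStep F ι),
      (∃ 𝔭 : Primes (Φ.obj (op (baseObj F A))),
          invDiv F ε hε.1.2 ∈ 𝔭.carrier ∧ invDiv F ι hι.1.2 ∈ 𝔭.carrier) ↔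
        ∃ 𝔮 : Primes (Φ₂.obj (op (baseObj F₂ (Ψ.functor.obj A)))),
          invDiv F₂ (Ψ.functor.map ε) (hprim ε hε).1.2 ∈ 𝔮.carrier ∧
            invDiv F₂ (Ψ.functor.map ι) (hprim ι hι).1.2 ∈ 𝔮.carrier := by
    intro E I ε ι hε hι
    rw [exists_common_prime_iff_not_isCoprimary hF histr hpf hε hι,
      exists_common_prime_iff_not_isCoprimary hF₂ histr₂ hpf₂ (hprim ε hε) (hprim ι hι),
      coprimary_map_iff Ψ hpre hpre' ε ι]
  -- choice of a primary pre-step representing each prime, on both sides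
  choose Z₁ ζ₁ hζ₁ hζ₁m using exists_isPrimaryPreStep_invDiv_mem hF A
  choose Z₂ ζ₂ hζ₂ hζ₂m using exists_isPrimaryPreStep_invDiv_mem hF₂ (Ψ.functor.obj A)
  -- the forward map and its characteristic property
  let f : Primes (Φ.obj (op (baseObj F A))) → Primes (Φ₂.obj (op (baseObj F₂ (Ψ.functor.obj A)))) :=
    fun 𝔭 => Quotient.mk _ ⟨_, isPrimary_invDiv (hprim (ζ₁ 𝔭) (hζ₁ 𝔭))⟩
  have hf : ∀ ⦃E : C⦄ (ε : E ⟶ A) (hε : IsPrimaryPreStep F ε) (𝔭 : Primes (Φ.obj (op (baseObj F A)))),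
      invDiv F ε hε.1.2 ∈ 𝔭.carrier →
        invDiv F₂ (Ψ.functor.map ε) (hprim ε hε).1.2 ∈ (f 𝔭).carrier := by
    intro E ε hε 𝔭 hε𝔭
    obtain ⟨𝔮, h1, h2⟩ := (same₁ hε (hζ₁ 𝔭)).mp ⟨𝔭, hε𝔭, hζ₁m 𝔭⟩
    have h3 : invDiv F₂ (Ψ.functor.map (ζ₁ 𝔭)) (hprim _ (hζ₁ 𝔭)).1.2 ∈ (f 𝔭).carrier :=
      mem_carrier_mk_of_isPrimary _
    rwa [← Primes.eq_of_mem_carrier h2 h3]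
  -- the backward map: transport a representative along `Ψ⁻¹` and the unit
  let ξ₁ : ∀ 𝔮 : Primes (Φ₂.obj (op (baseObj F₂ (Ψ.functor.obj A)))), Ψ.inverse.obj (Z₂ 𝔮) ⟶ A :=
    fun 𝔮 => Ψ.inverse.map (ζ₂ 𝔮) ≫ Ψ.unitInv.app A
  have hξ₁ : ∀ 𝔮, IsPrimaryPreStep F (ξ₁ 𝔮) := fun 𝔮 => (hprim' _ (hζ₂ 𝔮)).comp_iso hP _
  let g : Primes (Φ₂.obj (op (baseObj F₂ (Ψ.functor.obj A)))) → Primes (Φ.obj (op (baseObj F A))) :=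
    fun 𝔮 => Quotient.mk _ ⟨_, isPrimary_invDiv (hξ₁ 𝔮)⟩
  have hg : ∀ 𝔮, invDiv F (ξ₁ 𝔮) (hξ₁ 𝔮).1.2 ∈ (g 𝔮).carrier := fun 𝔮 => mem_carrier_mk_of_isPrimary _
  -- `Ψ(ξ₁ 𝔮) = counit ∘ ζ₂ 𝔮`, so its `x` is that of `ζ₂ 𝔮`
  have hΨξ : ∀ 𝔮, invDiv F₂ (Ψ.functor.map (ξ₁ 𝔮)) (hprim _ (hξ₁ 𝔮)).1.2 =
      invDiv F₂ (ζ₂ 𝔮) (hζ₂ 𝔮).1.2 := by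
    intro 𝔮
    have e : Ψ.functor.map (ξ₁ 𝔮) = Ψ.counit.app (Z₂ 𝔮) ≫ ζ₂ 𝔮 := by
      show Ψ.functor.map (Ψ.inverse.map (ζ₂ 𝔮) ≫ Ψ.unitInv.app A) = _
      rw [Functor.map_comp, Ψ.fun_inv_map, Category.assoc, Category.assoc, Ψ.counitInv_functor_comp,
        Category.comp_id]
    have h' : IsBaseIso F₂ (Ψ.counit.app (Z₂ 𝔮) ≫ ζ₂ 𝔮) := e ▸ (hprim _ (hξ₁ 𝔮)).1.2
    rw [show invDiv F₂ (Ψ.functor.map (ξ₁ 𝔮)) (hprim _ (hξ₁ 𝔮)).1.2 =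
        invDiv F₂ (Ψ.counit.app (Z₂ 𝔮) ≫ ζ₂ 𝔮) h' from by congr 1]
    exact invDiv_iso_comp hP₂ _ _ (hζ₂ 𝔮).1.2 h'
  -- `f ∘ g = id`
  have hfg : ∀ 𝔮, f (g 𝔮) = 𝔮 := by
    intro 𝔮
    have h1 := hf (ξ₁ 𝔮) (hξ₁ 𝔮) (g 𝔮) (hg 𝔮)
    rw [hΨξ] at h1
    exact Primes.eq_of_mem_carrier h1 (hζ₂m 𝔮)
  -- `g ∘ f = id`
  have hgf : ∀ 𝔭, g (f 𝔭) = 𝔭 := by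
    intro 𝔭
    -- `x_{ξ₁ (f 𝔭)}` and `x_{ζ₁ 𝔭}` share a prime since their `Ψ`-images do (both lie in `f 𝔭`)
    have h1 : invDiv F₂ (Ψ.functor.map (ξ₁ (f 𝔭))) (hprim _ (hξ₁ (f 𝔭))).1.2 ∈ (f 𝔭).carrier := by
      rw [hΨξ]; exact hζ₂m (f 𝔭)
    have h2 : invDiv F₂ (Ψ.functor.map (ζ₁ 𝔭)) (hprim _ (hζ₁ 𝔭)).1.2 ∈ (f 𝔭).carrier :=
      mem_carrier_mk_of_isPrimary _
    obtain ⟨𝔭', h3, h4⟩ := (same₁ (hξ₁ (f 𝔭)) (hζ₁ 𝔭)).mpr ⟨f 𝔭, h1, h2⟩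
    rw [Primes.eq_of_mem_carrier (hg (f 𝔭)) h3, Primes.eq_of_mem_carrier h4 (hζ₁m 𝔭)]
  refine ⟨⟨f, g, hgf, hfg⟩, hf, ?_⟩
  -- uniqueness
  intro e' he'
  ext 𝔭 : 1
  have h1 := he' (ζ₁ 𝔭) (hζ₁ 𝔭) 𝔭 (hζ₁m 𝔭)
  have h2 : invDiv F₂ (Ψ.functor.map (ζ₁ 𝔭)) (hprim _ (hζ₁ 𝔭)).1.2 ∈ (f 𝔭).carrier :=
    mem_carrier_mk_of_isPrimary _
  exact Primes.eq_of_mem_carrier h1 h2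


/-! ### Theorem 4.2 (i), primary steps into a Div-Frobenius-trivial object (perfect-type case) -/

/-- A step pre-composed with an isomorphism is a step. [cite: MochizukiFrdI2008, Def. 1.2(iii) p.22] -/
theorem IsStep.iso_comp {Z' Z A : C} (e : Z' ⟶ Z) [IsIso e] {ζ : Z ⟶ A} (hζ : IsStep F ζ) :
    IsStep F (e ≫ ζ) := by
  refine ⟨IsPreStep.comp F (isPreStep_of_isIso F e) hζ.1, fun h => hζ.2 ?_⟩
  have e' : ζ = inv e ≫ (e ≫ ζ) := by rw [IsIso.inv_hom_id_assoc]
  rw [e']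
  infer_instance

/-- A step post-composed with an isomorphism is a step. [cite: MochizukiFrdI2008, Def. 1.2(iii) p.22] -/
theorem IsStep.comp_iso {Z A A' : C} {ζ : Z ⟶ A} (hζ : IsStep F ζ) (e : A ⟶ A') [IsIso e] :
    IsStep F (ζ ≫ e) := by
  refine ⟨IsPreStep.comp F hζ.1 (isPreStep_of_isIso F e), fun h => hζ.2 ?_⟩
  have e' : ζ = (ζ ≫ e) ≫ inv e := by rw [Category.assoc, IsIso.hom_inv_id, Category.comp_id]
  rw [e']
  infer_instance

set_option backward.isDefEq.respectTransparency false in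
/-- **Theorem 4.2 (i), primary steps into a Div-Frobenius-trivial object, perfect-type case** (FrdI
p. 78: "it follows formally from Proposition 4.1, (i), (ii) [cf. also Theorem 3.4, (ii), (iii)] that `Ψ`
maps primary steps to … `A₁` to primary steps to … `A₂`"): for Frobenioids of perfect and isotropic
type, an equivalence `Ψ` which preserves steps, pre-steps and morphisms of Frobenius type and whose
quasi-inverse preserves steps [Thm. 3.4 (ii), (iii)], an object `A` with base-identity endomorphisms
`α_n` (Div-identity, of Frobenius type, of degree `n`) whose images `Ψ(α_n)` have the same three
properties [Prop. 1.14 (v); Thm. 3.4 (iii)] — all taken as HYPOTHESES — maps every primary step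
`φ : B → A` to a primary step `Ψ(φ) : Ψ(B) → Ψ(A)` (via the characterisation of Prop. 4.1 (i) on both
sides, transporting step-factorisations of `Ψ(φ)` back along `Ψ⁻¹`). The reduction of the general
(standard-type) case to the perfect-type case ("passing to perfections", Prop. 5.5 (iii)) is not in
this file. [cite: MochizukiFrdI2008, Thm. 4.2 (i) p.77] -/
theorem isPrimaryPreStep_map_of_divFrobeniusTrivial (hF : IsFrobenioid F) (hF₂ : IsFrobenioid F₂)
    (hperf : IsOfPerfectType F) (hperf₂ : IsOfPerfectType F₂)
    (histr : IsOfIsotropicType F) (histr₂ : IsOfIsotropicType F₂)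
    (hstep : ∀ ⦃X Y : C⦄ (φ : X ⟶ Y), IsStep F φ → IsStep F₂ (Ψ.functor.map φ))
    (hstep' : ∀ ⦃X Y : C₂⦄ (φ : X ⟶ Y), IsStep F₂ φ → IsStep F (Ψ.inverse.map φ))
    (hpre : ∀ ⦃X Y : C⦄ (φ : X ⟶ Y), IsPreStep F φ → IsPreStep F₂ (Ψ.functor.map φ))
    (hfrob : ∀ ⦃X Y : C⦄ (φ : X ⟶ Y), IsFrobeniusType F φ → IsFrobeniusType F₂ (Ψ.functor.map φ))
    {A : C} (α : ℕ+ → (A ⟶ A))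
    (hα : ∀ n, IsDivIdentity F (α n) ∧ IsFrobeniusType F (α n) ∧ degFr F (α n) = n)
    (hα₂ : ∀ n, IsDivIdentity F₂ (Ψ.functor.map (α n)) ∧ IsFrobeniusType F₂ (Ψ.functor.map (α n)) ∧
      degFr F₂ (Ψ.functor.map (α n)) = n)
    {B : C} {φ : B ⟶ A} (hφ : IsStep F φ) (hprim : IsPrimaryPreStep F φ) :
    IsPrimaryPreStep F₂ (Ψ.functor.map φ) := by
  have hP₂ := hF₂.isPreFrobenioid
  rw [isPrimaryPreStep_iff_of_isStep hF₂ hperf₂ histr₂ (fun n => Ψ.functor.map (α n)) hα₂ (hstep φ hφ)]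
  have h1 := (isPrimaryPreStep_iff_of_isStep hF hperf histr α hα hφ).mp hprim
  intro B' φB φA hφB hφA hfac
  -- pull the factorisation back to `C`
  have hcomp : Ψ.inverse.map φB ≫ Ψ.inverse.map φA = Ψ.unitInv.app B ≫ φ ≫ Ψ.unit.app A := by
    rw [← Functor.map_comp, hfac, Ψ.inv_fun_map]
  obtain ⟨n, B'', β', ζ', hβ', hζ', heq⟩ := h1 (Ψ.unit.app B ≫ Ψ.inverse.map φB)
    (Ψ.inverse.map φA ≫ Ψ.unitInv.app A) ((hstep' φB hφB).iso_comp (Ψ.unit.app B))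
    ((hstep' φA hφA).comp_iso (Ψ.unitInv.app A)) (by simp [reassoc_of% hcomp])
  -- and push the witnesses forward to `C₂`
  refine ⟨n, Ψ.functor.obj B'', Ψ.counitInv.app B' ≫ Ψ.functor.map β', Ψ.functor.map ζ',
    IsFrobeniusType.comp F₂ hF₂ (isFrobeniusType_of_isIso F₂ hP₂ _) (hfrob β' hβ'), hpre ζ' hζ', ?_⟩
  have h2 : Ψ.functor.map (Ψ.inverse.map φA ≫ Ψ.unitInv.app A) = Ψ.counit.app B' ≫ φA := by
    rw [Functor.map_comp, Ψ.fun_inv_map, Category.assoc, Category.assoc, Ψ.counitInv_functor_comp,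
      Category.comp_id]
  have h4 : (Ψ.counit.app B' ≫ φA) ≫ Ψ.functor.map (α n) =
      Ψ.functor.map β' ≫ Ψ.functor.map ζ' ≫ Ψ.functor.map φ := by
    have h3 := congrArg Ψ.functor.map heq
    rw [Functor.map_comp] at h3
    rw [h2, Functor.map_comp, Functor.map_comp] at h3
    exact h3
  calc φA ≫ Ψ.functor.map (α n)
      = Ψ.counitInv.app B' ≫ ((Ψ.counit.app B' ≫ φA) ≫ Ψ.functor.map (α n)) := by simp
    _ = (Ψ.counitInv.app B' ≫ Ψ.functor.map β') ≫ Ψ.functor.map ζ' ≫ Ψ.functor.map φ := by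
        rw [h4]; simp only [Category.assoc]


set_option backward.isDefEq.respectTransparency false in
/-- **Theorem 4.2 (i), primary composites through an object, perfect-type case** (FrdI p. 78: "primary
steps `B₁ → A₁`, `A₁ → C₁` with primary composite `B₁ → C₁` are mapped to primary steps `B₂ → A₂`,
`A₂ → C₂` with primary composite", via Prop. 4.1 (ii)): for Frobenioids of perfect and isotropic type
with perf-factorial divisor monoids, an equivalence `Ψ` preserving steps and pre-steps with `Ψ⁻¹`
preserving steps [Thm. 3.4 (ii)], and an object `A` such that `Ψ` preserves the primary steps INTO `A`
— HYPOTHESES — if `φ : B → A` is a primary step and `ψ : A → C` a step with `ψ ∘ φ` and `ψ` primary,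
then `Ψ(ψ) ∘ Ψ(φ)` and `Ψ(ψ)` are primary (Prop. 4.1 (ii) in `C₁`, transport of its step-factorisation
condition, Prop. 4.1 (ii) in `C₂`). [cite: MochizukiFrdI2008, Thm. 4.2 (i) p.77] -/
theorem isPrimaryPreStep_comp_map (hF : IsFrobenioid F) (hF₂ : IsFrobenioid F₂)
    (hperf : IsOfPerfectType F) (hperf₂ : IsOfPerfectType F₂)
    (histr : IsOfIsotropicType F) (histr₂ : IsOfIsotropicType F₂)
    (hpf : Objectwise (fun M _ => IsPerfFactorial M) Φ)
    (hpf₂ : Objectwise (fun M _ => IsPerfFactorial M) Φ₂)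
    (hstep : ∀ ⦃X Y : C⦄ (φ : X ⟶ Y), IsStep F φ → IsStep F₂ (Ψ.functor.map φ))
    (hstep' : ∀ ⦃X Y : C₂⦄ (φ : X ⟶ Y), IsStep F₂ φ → IsStep F (Ψ.inverse.map φ))
    (hpre : ∀ ⦃X Y : C⦄ (φ : X ⟶ Y), IsPreStep F φ → IsPreStep F₂ (Ψ.functor.map φ))
    {A : C}
    (hprimA : ∀ ⦃E : C⦄ (ε : E ⟶ A), IsStep F ε → IsPrimaryPreStep F ε →
      IsPrimaryPreStep F₂ (Ψ.functor.map ε))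
    {B C' : C} {φ : B ⟶ A} {ψ : A ⟶ C'} (hφ : IsStep F φ) (hφp : IsPrimaryPreStep F φ)
    (hψ : IsStep F ψ) (hcomp : IsPrimaryPreStep F (φ ≫ ψ)) (hψp : IsPrimaryPreStep F ψ) :
    IsPrimaryPreStep F₂ (Ψ.functor.map φ ≫ Ψ.functor.map ψ) ∧ IsPrimaryPreStep F₂ (Ψ.functor.map ψ) := by
  have h1 := (isPrimaryPreStep_comp_iff_of_isStep hF hperf histr hpf hφ hφp hψ).mp ⟨hcomp, hψp⟩
  refine (isPrimaryPreStep_comp_iff_of_isStep hF₂ hperf₂ histr₂ hpf₂ (hstep φ hφ) (hprimA φ hφ hφp)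
    (hstep ψ hψ)).mpr ?_
  intro A' φ' ψ' hφ' hψ' hfac
  -- pull the factorisation `ψ' ∘ φ' = Ψ(ψ ∘ φ)` back to `C`
  have hcm : Ψ.inverse.map φ' ≫ Ψ.inverse.map ψ' = Ψ.unitInv.app B ≫ (φ ≫ ψ) ≫ Ψ.unit.app C' := by
    rw [← Functor.map_comp, hfac, ← Functor.map_comp, Ψ.inv_fun_map]
  obtain ⟨A'', φ'', ζ, ζ', hφ'', hζ, hζ', e₁, e₂⟩ := h1 (Ψ.unit.app B ≫ Ψ.inverse.map φ')
    (Ψ.inverse.map ψ' ≫ Ψ.unitInv.app C') ((hstep' φ' hφ').iso_comp (Ψ.unit.app B))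
    ((hstep' ψ' hψ').comp_iso (Ψ.unitInv.app C')) (by simp [reassoc_of% hcm])
  -- and push the witnesses forward
  refine ⟨Ψ.functor.obj A'', Ψ.functor.map φ'', Ψ.functor.map ζ, Ψ.functor.map ζ' ≫ Ψ.counit.app A',
    hstep φ'' hφ'', hpre ζ hζ, IsPreStep.comp F₂ (hpre ζ' hζ') (isPreStep_of_isIso F₂ _),
    by rw [← Functor.map_comp, e₁], ?_⟩
  rw [← Ψ.functor.map_comp_assoc, e₂, Functor.map_comp, Ψ.fun_inv_map]
  simp

/-- **Theorem 4.2 (i), primary steps out of an object, perfect-type case** (FrdI p. 78: "`Ψ` maps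
primary steps to or from `A₁` to primary steps to or from `A₂`"): under the hypotheses of
`isPrimaryPreStep_comp_map`, every primary step `ψ : A → C` maps to a primary step `Ψ(ψ)`. Proof:
choose (Def. 1.3 (iii)(d)) a primary step `φ : B → A` with `x_φ = Div(ψ)`, so that
`Div(ψ ∘ φ) = φ^*(2·Div ψ)` is primary, and apply `isPrimaryPreStep_comp_map`.
[cite: MochizukiFrdI2008, Thm. 4.2 (i) p.77] -/
theorem isPrimaryPreStep_map_of_from (hF : IsFrobenioid F) (hF₂ : IsFrobenioid F₂)
    (hperf : IsOfPerfectType F) (hperf₂ : IsOfPerfectType F₂)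
    (histr : IsOfIsotropicType F) (histr₂ : IsOfIsotropicType F₂)
    (hpf : Objectwise (fun M _ => IsPerfFactorial M) Φ)
    (hpf₂ : Objectwise (fun M _ => IsPerfFactorial M) Φ₂)
    (hstep : ∀ ⦃X Y : C⦄ (φ : X ⟶ Y), IsStep F φ → IsStep F₂ (Ψ.functor.map φ))
    (hstep' : ∀ ⦃X Y : C₂⦄ (φ : X ⟶ Y), IsStep F₂ φ → IsStep F (Ψ.inverse.map φ))
    (hpre : ∀ ⦃X Y : C⦄ (φ : X ⟶ Y), IsPreStep F φ → IsPreStep F₂ (Ψ.functor.map φ))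
    {A : C}
    (hprimA : ∀ ⦃E : C⦄ (ε : E ⟶ A), IsStep F ε → IsPrimaryPreStep F ε →
      IsPrimaryPreStep F₂ (Ψ.functor.map ε))
    {C' : C} {ψ : A ⟶ C'} (hψ : IsStep F ψ) (hψp : IsPrimaryPreStep F ψ) :
    IsPrimaryPreStep F₂ (Ψ.functor.map ψ) := by
  have hP := hF.isPreFrobenioid
  -- a primary step `φ : B → A` with `x_φ = Div ψ`
  obtain ⟨B, φ, hφco, hφx⟩ := hF.iii_d_over_surj A (Div F ψ)
  have hφp : IsPrimaryPreStep F φ := isPrimaryPreStep_of_isPrimary_invDiv hφco.2 (hφx ▸ hψp.2)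
  have hφ : IsStep F φ := by
    refine ⟨hφco.2, fun h => hφp.2.1 ?_⟩
    exact isIsometry_of_isIso F hP φ
  haveI : IsIso (Base F φ) := hφ.1.2
  have hcomp : IsPrimaryPreStep F (φ ≫ ψ) := by
    refine ⟨IsPreStep.comp F hφ.1 hψ.1, ?_⟩
    have hdφ : Div F φ = pull Φ (Base F φ) (Div F ψ) := by rw [← hφx, pull_invDiv]
    rw [div_comp_of_isLinear φ hψ.1.1, hdφ, ← map_mul, ← pow_two]
    exact (isPrimary_pull_iff (Base F φ) _).mpr
      (hψp.2.pow (hP.isDivisorial (baseObj F A)).isSharp two_pos)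
  exact (isPrimaryPreStep_comp_map Ψ hF hF₂ hperf hperf₂ histr histr₂ hpf hpf₂ hstep hstep' hpre hprimA
    hφ hφp hψ hcomp hψp).2

end PreFrobenioid

end Literature.AlgebraicGeometry.Frobenioids
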